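import Mathlib
import Summits.NavierStokesRegularity.NavierStokesRegularity.Theorems.TaoLadderRungTwoBreakOneShiftWindowStepEndV
import Summits.NavierStokesRegularity.NavierStokesRegularity.Theorems.TaoLadderRungTwoBreakOneShiftWindowPairStepReal
import HarnessLib

/-!
# The one-shift window system, LVI: THE ROUGH STEP AND THE PAIR SLOPE WITH THE POINT-TIME C¹ FORM —
# `RoughStepD.soundE` (part XXXI `sound` + the fourth clause of part LV) and `PairStepD.sound_end`: for any two runs of
# the same rough realisation from `a, b` in the start box, `S_u(h) − S_v(h) = U (a − b)` with
# `U ∈ [endMatI [h,h] − Ẑ₂, endMatI [h,h] + Ẑ₂]` — the END-OF-STEP slope enclosure `A_s^E` of the replay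
# (cell harvest/h2-tao-ladder, seat p2; rung1/KERNEL-CHEAP-REPLAY-SPEC.md §2 (e)/(g); support for K1(1) =
# `NoSurvivingDSSOne`, stmt-NavierStokesRegularity-20205)

Part XXXVI `PairStepD.sound` verbatim except that the mean-value box for the centre flow at time `h` is the
point-time Taylor form of part LV instead of the all-`τ` C¹ box `VV` (which contains the identity): the per-step
slope `A_s` no longer carries the width `h‖Df‖` (see the module docstring of part LV for the numbers).

MODEL lattice ODEs only (Tao 2016 §4 normal form on Tao's shift set `S`); nothing here is a statement about
the Navier–Stokes equations; no item is closed; no instance is evaluated here. Generic in `ι`, `κ`.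
-/

-- the sub-problem namespace repeats the summit name by design (D-0017)
set_option linter.dupNamespace false

namespace Summit.NavierStokesRegularity.NavierStokesRegularity.Theorems

namespace DSSOneShift

open Set Finset Metric Filter Topology TopologicalSpace
open Literature.Analysis.ODE
open Summit.NavierStokesRegularity.NavierStokesRegularity.Theorems.TaylorModelCert
open Summit.NavierStokesRegularity.NavierStokesRegularity.Theorems.TaylorModelReadout
open Summit.NavierStokesRegularity.NavierStokesRegularity.Theorems.CertificateGlueOn

namespace RoughStepD

variable (d : RoughStepD)

section Sound

variable {ι : Type*} [Fintype ι] [DecidableEq ι] {κ : Type*} [Fintype κ]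

/-- **SOUNDNESS OF THE ROUGH-STEP TEST, WITH THE POINT-TIME C¹ FORM** (part XXXI `sound` + the fourth clause of
part LV `CentreStepD.soundE`). [cite: KapelaZgliczynski2009, §4 Lemma 4.1; WalawskaWilczak2016, §2.2 Lemma 2; Moore1979, §8.1 eq. (8.13)] -/
theorem soundE (e : ι ≃ Fin d.n) {Tc : κ → BTerm ι} {Tf : ℝ → κ → BTerm ι} {rows : ι → List κ}
    (hRDc : IsRTEncl e Tc Tc rows d.RD) (hRD : ∀ t ∈ Ico 0 d.hD.toReal, IsRTEncl e Tc (Tf t) rows d.RD)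
    (hc : d.check = true) :
    ∃ uc : (ι → ℝ) → ℝ → ι → ℝ,
      IsSolutionFamily (termField Tc) (boxSet (boxOf e d.S)) (boxSet (boxOf e d.W)) d.hD.toReal uc ∧
      (∀ z : ℝ → ι → ℝ, z 0 ∈ boxSet (boxOf e d.W) →
        (∀ t ∈ Icc 0 d.hD.toReal, HasDerivWithinAt z (termField Tc (z t)) (Icc 0 d.hD.toReal) t) →
        ∀ t ∈ Icc 0 d.hD.toReal, z t ∈ boxSet (boxOf e d.S)) ∧
      (∀ x ∈ boxSet (boxOf e d.W), ∀ τ ∈ Icc 0 d.hD.toReal, ∃ J : (ι → ℝ) →L[ℝ] (ι → ℝ),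
        HasFDerivWithinAt (fun x' => uc x' τ) J (boxSet (boxOf e d.W)) x ∧
        ∀ i l, (d.centre.vv (e i) (e l)).lo.toReal ≤ J (Pi.single l 1) i ∧
          J (Pi.single l 1) i ≤ (d.centre.vv (e i) (e l)).hi.toReal) ∧
      (∀ x ∈ boxSet (boxOf e d.W), ∀ τ ∈ Icc 0 d.hD.toReal, ∀ TI : IntervalD, IntervalD.mem τ TI →
        ∃ J : (ι → ℝ) →L[ℝ] (ι → ℝ),
        HasFDerivWithinAt (fun x' => uc x' τ) J (boxSet (boxOf e d.W)) x ∧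
        ∀ i l, IntervalD.mem (J (Pi.single l 1) i) (d.centre.endMatI TI (e i) (e l))) ∧
      boxSet (boxOf e d.S) ⊆ boxSet (boxOf e d.Hs) ∧
      ∀ a ∈ boxSet (boxOf e d.W), ∀ Su : ℝ → ι → ℝ, Su 0 = a →
        (∀ t ∈ Icc 0 d.hD.toReal, HasDerivWithinAt Su (termField (Tf t) (Su t)) (Icc 0 d.hD.toReal) t) →
        ∀ t ∈ Icc 0 d.hD.toReal, Su t ∈ boxSet (boxOf e d.Hs) ∧ ∀ i, |Su t i - uc a t i| ≤ (dget d.Zh (e i)).toReal := by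
  classical
  have hc' : d.centre.check = true ∧ d.checkKZ = true := by simpa [check, Bool.and_eq_true] using hc
  obtain ⟨hcc, hkz⟩ := hc'
  obtain ⟨heta, hK⟩ := d.of_checkKZ hkz
  -- the centre step
  obtain ⟨uc, hu, hstay, hder, hderE⟩ := d.centre.soundE Tc e (isSQEnclosure_sqC e hRDc d.prec) hcc
  have hcS := (d.centre.of_checkWith (by rw [← CentreStepD.check_eq]; exact hcc)).2.2.1
  have hh : 0 ≤ d.hD.toReal := (d.centre.of_checkWith (by rw [← CentreStepD.check_eq]; exact hcc)).2.1
  have hwfS : ∀ c < d.n, wfsD (IntervalD.aget d.S c) = true := fun c hc => (hcS c hc).2.1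
  have hZ : ∀ c < d.n, 0 ≤ (dget d.Zh c).toReal := fun c hc => (hK c hc).1
  have hSH := d.boxSet_S_subset_Hs e hwfS hZ heta
  refine ⟨uc, hu, hstay, hder, hderE, hSH, fun a ha Su hSu0 hSu t ht => ?_⟩
  -- the K–Z data on the hull
  set Hr := boxOf e d.Hs with hHr
  set dg : ι → ℝ := fun i => (d.dgD (e i)).toReal with hdg
  set R : ι → ι → ℝ := fun i j => (d.RD' (e i) (e j)).toReal with hRdef
  set cb : ι → ℝ := fun i => (d.cbD (e i)).toReal with hcb
  set Zb : ι → ℝ := fun i => (dget d.Zh (e i)).toReal with hZb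
  set E : ι → ℝ := fun i => (d.ED (e i)).toReal with hE
  set ζ : ι → ℝ := fun i => (dget d.zeta (e i)).toReal with hζ
  have hmemH : ∀ x ∈ boxSet Hr, ∀ i, IntervalD.mem (x i) (IntervalD.aget d.Hs (e i)) := fun x hx i =>
    d.mem_of_mem_Hs e hwfS hZ heta hx i
  -- Jacobian bounds
  have hjac : ∀ x ∈ boxSet Hr, ∀ i j, IntervalD.mem (jacEntry Tc x i j) (d.jac (e i) (e j)) := fun x hx i j =>
    mem_jacEntry_jacRow e hRDc d.prec (hmemH x hx) i j
  have hdgb : ∀ x ∈ boxSet Hr, ∀ i, (termFieldDeriv Tc x) (Pi.single i 1) i ≤ dg i := fun x hx i => by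
    rw [termFieldDeriv_single]; exact (hjac x hx i i).2
  have hR0 : ∀ i j, 0 ≤ R i j := fun i j => by
    simp only [hRdef, RD']
    split_ifs
    · simp
    · exact mag_toReal_nonneg _
  have hRb : ∀ x ∈ boxSet Hr, ∀ i j, i ≠ j → |(termFieldDeriv Tc x) (Pi.single j 1) i| ≤ R i j := by
    intro x hx i j hij
    rw [termFieldDeriv_single]
    simp only [hRdef, RD', if_neg (fun h => hij (e.injective (Fin.ext h)))]
    exact IntervalD.abs_le_mag (hjac x hx i j)
  have hcb0 : ∀ i, 0 ≤ cb i := fun i => mag_toReal_nonneg _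
  have hδ : ∀ t ∈ Ico 0 d.hD.toReal, ∀ x ∈ boxSet Hr, ∀ i, |termField (Tf t) x i - termField Tc x i| ≤ cb i :=
    fun t ht x hx i => abs_termField_sub_le_cbRow e (hRD t ht) d.prec (hmemH x hx) i
  have hZb0 : ∀ i, 0 ≤ Zb i := fun i => hZ (e i) (e i).isLt
  have hEb : ∀ i, gronwallBound 0 (dg i) 1 d.hD.toReal ≤ E i := by
    intro i
    have hx := (hK (e i) (e i).isLt).2.2.1
    simp only [xplus, Dyad.toReal_max, Dyad.toReal_mul, Dyad.toReal_ofInt, Int.cast_zero, max_le_iff] at hx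
    refine (gronwallBound_le_lin hh hx.1).trans (le_of_eq ?_)
    simp only [hE, ED, xplus, Dyad.toReal_mul, Dyad.toReal_add, Dyad.toReal_max, Dyad.toReal_ofInt]
    push_cast; ring
  -- the two K–Z inequalities from the interval checks
  have hkz : ∀ i (v : ℕ → Dyad) (w : Dyad),
      IntervalD.mem (((∑ j, R i j * (v (e j)).toReal) + w.toReal) * E i) (d.kzLhs (e i) v w) := by
    intro i v w
    unfold kzLhs
    refine IntervalD.mem_mulR d.prec (IntervalD.mem_addR d.prec ?_ (IntervalD.mem_ofDyad w)) (IntervalD.mem_ofDyad _)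
    refine mem_sum_equiv e d.prec fun k hk => ?_
    simp only [hRdef, Equiv.apply_symm_apply]
    exact IntervalD.mem_mulR d.prec (IntervalD.mem_ofDyad _) (IntervalD.mem_ofDyad _)
  have hfix : ∀ i, ((∑ j, R i j * Zb j) + cb i) * E i ≤ Zb i := fun i =>
    IntervalD.le_of_hiLe (hK (e i) (e i).isLt).2.2.2.1 (hkz i (dget d.Zh) (d.cbD (e i)))
  have hζ0 : ∀ i, 0 < ζ i := fun i => (hK (e i) (e i).isLt).2.1
  have hdir : ∀ i, (∑ j, R i j * ζ j) * E i ≤ ζ i := fun i => by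
    have h := IntervalD.le_of_hiLe (hK (e i) (e i).isLt).2.2.2.2 (hkz i (dget d.zeta) (Dyad.ofInt 0))
    simpa using h
  -- the bootstrap
  have hres := stepDeviation_bootstrap hh (convex_boxSet Hr) (isClosed_Icc)
    (f := fun t x => termField (Tf t) x) (fc := termField Tc) (fc' := termFieldDeriv Tc) (S := Su) (C := uc a)
    hSu (hu.hasDerivWithinAt a ha) (by rw [hSu0, hu.init a ha]) (fun t ht => hSH (hu.mem a ha t ht))
    (dg := dg) (cb := cb) (Zb := Zb) (E := E) (ζ := ζ) (R := R)
    (fun t ht y hy => d.hull_nhds e hwfS heta (hu.mem a ha t ht) hy)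
    (fun x _ => hasFDerivWithinAt_termField Tc _ x) hdgb hR0 hRb hcb0 hδ hZb0 hEb hfix hζ0 hdir t ht
  exact hres

end Sound

end RoughStepD

namespace PairStepD

variable (d : PairStepD) {ι : Type*} [Fintype ι] [DecidableEq ι] {κ : Type*} [Fintype κ]

/-- **SOUNDNESS OF THE PAIR-SLOPE STEP TEST WITH THE END-OF-STEP SLOPE IN THE POINT-TIME FORM.**
[cite: KapelaZgliczynski2009, §4 Lemma 4.1 / Thm. 9; WalawskaWilczak2016, §2.1 and §2.2 Lemma 2; Moore1979, §8.1 eq. (8.13)] -/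
theorem sound_end (e : ι ≃ Fin d.n) {Tc : κ → BTerm ι} {Tf : ℝ → κ → BTerm ι} {rows : ι → List κ}
    (hRDc : IsRTEncl e Tc Tc rows d.RD) (hRD : ∀ t ∈ Ico 0 d.hD.toReal, IsRTEncl e Tc (Tf t) rows d.RD)
    (hc : d.check = true) {a b : ι → ℝ} (ha : a ∈ boxSet (boxOf e d.W)) (hb : b ∈ boxSet (boxOf e d.W))
    {Su Sv : ℝ → ι → ℝ} (hSu0 : Su 0 = a) (hSv0 : Sv 0 = b)
    (hSu : ∀ t ∈ Icc 0 d.hD.toReal, HasDerivWithinAt Su (termField (Tf t) (Su t)) (Icc 0 d.hD.toReal) t)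
    (hSv : ∀ t ∈ Icc 0 d.hD.toReal, HasDerivWithinAt Sv (termField (Tf t) (Sv t)) (Icc 0 d.hD.toReal) t) :
    ∃ U : Matrix ι ι ℝ,
      (∀ i j, (d.toRoughStepD.centre.endMatI (IntervalD.ofDyad d.hD) (e i) (e j)).lo.toReal - d.cZh e i j ≤ U i j ∧
        U i j ≤ (d.toRoughStepD.centre.endMatI (IntervalD.ofDyad d.hD) (e i) (e j)).hi.toReal + d.cZh e i j) ∧
      Su d.hD.toReal - Sv d.hD.toReal = U.mulVec (a - b) := by
  classical
  -- unpack the Booleans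
  have hc' : d.toRoughStepD.check = true ∧ d.checkPair = true := by simpa [check, Bool.and_eq_true] using hc
  obtain ⟨hrc, hpc⟩ := hc'
  have hrc' : d.toRoughStepD.centre.check = true ∧ d.toRoughStepD.checkKZ = true := by
    simpa [RoughStepD.check, Bool.and_eq_true] using hrc
  obtain ⟨hcc, hkz⟩ := hrc'
  obtain ⟨heta, hK⟩ := d.toRoughStepD.of_checkKZ hkz
  have hcw := d.toRoughStepD.centre.of_checkWith (by rw [← CentreStepD.check_eq]; exact hcc)
  have hh : 0 ≤ d.hD.toReal := hcw.2.1
  have hwfW : ∀ c < d.n, wfD (IntervalD.aget d.W c) = true := fun c hc => (hcw.2.2.1 c hc).1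
  have hwfS : ∀ c < d.n, wfsD (IntervalD.aget d.S c) = true := fun c hc => (hcw.2.2.1 c hc).2.1
  have hZ1 : ∀ c < d.n, 0 ≤ (RoughStepD.dget d.Zh c).toReal := fun c hc => (hK c hc).1
  have hP := d.of_checkPair hpc
  -- the rough step, the slope data, the growth bound
  obtain ⟨uc, hu, -, hder, hderE, hSH, hrough⟩ := d.toRoughStepD.soundE e hRDc hRD hrc
  obtain ⟨D, hDh, hDdg, hDR, hDBt, hDL, hDprox, hDWb, hDE, hDZh, hDζ⟩ := d.exists_slopeData e hRDc hc
  have hmemH : ∀ x ∈ boxSet (boxOf e d.Hs), ∀ i, IntervalD.mem (x i) (IntervalD.aget d.Hs (e i)) := fun x hx i =>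
    d.toRoughStepD.mem_of_mem_Hs e hwfS hZ1 heta hx i
  have hmemW : ∀ x ∈ boxSet (boxOf e d.W), ∀ i, IntervalD.mem (x i) (IntervalD.aget d.W (e i)) := fun x hx i =>
    mem_of_mem_toNI (hwfW (e i) (e i).isLt) ((mem_boxSet_iff.1 hx) i)
  have hSuH : ∀ t ∈ Icc 0 d.hD.toReal, Su t ∈ boxSet (boxOf e d.Hs) := fun t ht => (hrough a ha Su hSu0 hSu t ht).1
  have hSvH : ∀ t ∈ Icc 0 d.hD.toReal, Sv t ∈ boxSet (boxOf e d.Hs) := fun t ht => (hrough b hb Sv hSv0 hSv t ht).1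
  have hWb := d.abs_pair_le_Wb e hRDc hRD hc hmemH hSu0 hSv0 hSu hSv
    (fun t ht => ⟨hSuH t (Ico_subset_Icc_self ht), hSvH t (Ico_subset_Icc_self ht)⟩)
  -- centre Jacobian bounds on the hull
  have hjacC : ∀ x ∈ boxSet (boxOf e d.Hs), ∀ i j, IntervalD.mem (jacEntry Tc x i j) (d.toRoughStepD.jac (e i) (e j)) :=
    fun x hx i j => mem_jacEntry_jacRow e hRDc d.prec (hmemH x hx) i j
  -- the centre pair difference via the flow derivative (part XIV)
  have hdiam : ∀ l, |a l - b l| ≤ (d.diam (e l)).toReal := by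
    intro l
    have ha' := hmemW a ha l
    have hb' := hmemW b hb l
    simp only [PairStepD.diam, Dyad.toReal_sub]
    rw [abs_le]; constructor <;> linarith [ha'.1, ha'.2, hb'.1, hb'.2]
  have hcentre : ∀ t ∈ Icc 0 d.hD.toReal, ∀ k, |uc a t k - uc b t k| ≤ ∑ l, (d.magVV (e k) (e l)).toReal * |a l - b l| := by
    intro t ht k
    have hJ : ∀ x ∈ boxSet (boxOf e d.W), ∃ J : (ι → ℝ) →L[ℝ] (ι → ℝ),
        HasFDerivWithinAt (fun x' => uc x' t) J (boxSet (boxOf e d.W)) x ∧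
        ∀ i l, (d.toRoughStepD.centre.vv (e i) (e l)).lo.toReal ≤ J (Pi.single l 1) i ∧
          J (Pi.single l 1) i ≤ (d.toRoughStepD.centre.vv (e i) (e l)).hi.toReal := fun x hx => hder x hx t ht
    choose! J hJd hJe using hJ
    obtain ⟨M, hM, hrep⟩ := exists_slopeMatrix_of_fderiv (convex_boxSet (boxOf e d.W)) (Φ := fun x' => uc x' t)
      (Φ' := J) (CV := fun i l => (d.toRoughStepD.centre.vv (e i) (e l)).lo.toReal)
      (DV := fun i l => (d.toRoughStepD.centre.vv (e i) (e l)).hi.toReal) hJd (fun x hx i l => hJe x hx i l) ha hb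
    have hk := congrFun hrep k
    simp only [Pi.sub_apply] at hk
    rw [hk, Matrix.mulVec, dotProduct]
    refine (Finset.abs_sum_le_sum_abs _ _).trans (Finset.sum_le_sum fun l _ => ?_)
    rw [abs_mul, Pi.sub_apply]
    exact mul_le_mul_of_nonneg_right (IntervalD.abs_le_mag ⟨(hM k l).1, (hM k l).2⟩) (abs_nonneg _)
  -- hprox
  have hproxb : ∀ t ∈ Ico 0 d.hD.toReal, ∀ k,
      |Su t k - Sv t k| + |Sv t k - uc b t k| + |uc a t k - uc b t k| ≤ d.cProx e k := by
    intro t ht k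
    have h1 := hWb t ht k
    have h2 := (hrough b hb Sv hSv0 hSv t (Ico_subset_Icc_self ht)).2 k
    have h3 := hcentre t (Ico_subset_Icc_self ht) k
    have hm : IntervalD.mem ((∑ l, d.cWb e k l * (d.diam (e l)).toReal) + (RoughStepD.dget d.Zh (e k)).toReal +
        ∑ l, (d.magVV (e k) (e l)).toReal * (d.diam (e l)).toReal)
        (IntervalD.addR d.prec (IntervalD.addR d.prec
          (IntervalD.rangeSumR d.prec (fun l => IntervalD.mulR d.prec (IntervalD.ofDyad (d.Wb (e k) l)) (IntervalD.ofDyad (d.diam l))) d.n)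
          (IntervalD.ofDyad (RoughStepD.dget d.Zh (e k))))
          (IntervalD.rangeSumR d.prec (fun l => IntervalD.mulR d.prec (IntervalD.ofDyad (d.magVV (e k) l)) (IntervalD.ofDyad (d.diam l))) d.n)) := by
      refine IntervalD.mem_addR d.prec (IntervalD.mem_addR d.prec ?_ (IntervalD.mem_ofDyad _)) ?_
      · exact mem_sum_equiv e d.prec fun c hc => by
          simp only [cWb, Equiv.apply_symm_apply]
          exact IntervalD.mem_mulR d.prec (IntervalD.mem_ofDyad _) (IntervalD.mem_ofDyad _)
      · exact mem_sum_equiv e d.prec fun c hc => by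
          simp only [Equiv.apply_symm_apply]
          exact IntervalD.mem_mulR d.prec (IntervalD.mem_ofDyad _) (IntervalD.mem_ofDyad _)
    have hle : (∑ l, d.cWb e k l * (d.diam (e l)).toReal) + (RoughStepD.dget d.Zh (e k)).toReal +
        ∑ l, (d.magVV (e k) (e l)).toReal * (d.diam (e l)).toReal ≤ d.cProx e k := by
      unfold cProx PairStepD.proxD; exact hm.2
    have hWb0 : ∀ l, 0 ≤ d.cWb e k l := fun l => by rw [← hDWb]; exact D.Wb_nonneg k l
    have h1' : |Su t k - Sv t k| ≤ ∑ l, d.cWb e k l * (d.diam (e l)).toReal :=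
      h1.trans (Finset.sum_le_sum fun l _ => mul_le_mul_of_nonneg_left (hdiam l) (hWb0 l))
    have h3' : |uc a t k - uc b t k| ≤ ∑ l, (d.magVV (e k) (e l)).toReal * (d.diam (e l)).toReal :=
      h3.trans (Finset.sum_le_sum fun l _ => mul_le_mul_of_nonneg_left (hdiam l) (mag_toReal_nonneg _))
    linarith
  -- the flow derivative at time h, POINT-TIME form (part LV)
  have hJh : ∀ x ∈ boxSet (boxOf e d.W), ∃ Jx : (ι → ℝ) →L[ℝ] (ι → ℝ),
      HasFDerivWithinAt (fun x' => uc x' d.hD.toReal) Jx (boxSet (boxOf e d.W)) x ∧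
      ∀ i l, (d.toRoughStepD.centre.endMatI (IntervalD.ofDyad d.hD) (e i) (e l)).lo.toReal ≤ Jx (Pi.single l 1) i ∧
        Jx (Pi.single l 1) i ≤ (d.toRoughStepD.centre.endMatI (IntervalD.ofDyad d.hD) (e i) (e l)).hi.toReal := by
    intro x hx
    obtain ⟨Jx, hJx, hm⟩ := hderE x hx _ ⟨hh, le_rfl⟩ (IntervalD.ofDyad d.hD) (IntervalD.mem_ofDyad d.hD)
    exact ⟨Jx, hJx, fun i l => ⟨(hm i l).1, (hm i l).2⟩⟩
  choose! Jh hJhd hJhe using hJh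
  -- feed part XVI (all statements rewritten to the fields of `D`)
  rw [← hDh] at hSu hSv hrough hu hproxb hWb hJhd
  obtain ⟨U, hU, hrep⟩ := exists_stepPairSlope D (Hs := boxSet (boxOf e d.Hs)) (X := boxSet (boxOf e d.W))
    (convex_boxSet _) (convex_boxSet _)
    (f := fun t => termField (Tf t)) (f' := fun t x => termFieldDeriv (Tf t) x) (fc := termField Tc) (fc' := termFieldDeriv Tc)
    (uc := uc) (Φc' := Jh)
    (CV := fun i l => (d.toRoughStepD.centre.endMatI (IntervalD.ofDyad d.hD) (e i) (e l)).lo.toReal)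
    (DV := fun i l => (d.toRoughStepD.centre.endMatI (IntervalD.ofDyad d.hD) (e i) (e l)).hi.toReal) (Su := Su) (Sv := Sv) ha hb
    hSu hSu0 hSv hSv0 (fun x hx t ht => hu.hasDerivWithinAt x hx t ht) (fun x hx => hu.init x hx)
    (fun t ht => ⟨(hrough a ha Su hSu0 hSu t (Ico_subset_Icc_self ht)).1, (hrough b hb Sv hSv0 hSv t (Ico_subset_Icc_self ht)).1,
      hSH (hu.mem a ha t (Ico_subset_Icc_self ht)), hSH (hu.mem b hb t (Ico_subset_Icc_self ht))⟩)
    (fun t _ x _ => hasFDerivWithinAt_termField (Tf t) _ x)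
    (fun x _ => hasFDerivWithinAt_termField Tc _ x)
    (fun x hx i => by rw [hDdg, termFieldDeriv_single]; exact (hjacC x hx i i).2)
    (fun x hx i j hij => by
      rw [hDR, termFieldDeriv_single]
      show |jacEntry Tc x i j| ≤ colVal (d.RcRow (e i)) (e j)
      rw [PairStepD.RcRow, colVal_filter_ne (fun h' => hij (e.injective (Fin.ext h')).symm)]
      exact abs_jacEntry_le_colVal_centre e hRDc d.prec (hmemH x hx) i j)
    (fun t ht x _ x' _ i j => by
      rw [hDBt, hDL, termFieldDeriv_single, termFieldDeriv_single]
      exact abs_jacEntry_sub_le_Bt_L e (hRD t (by rwa [← hDh])) x x' i j)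
    (fun t ht k => by rw [hDprox]; exact hproxb t ht k)
    (fun t ht j => by rw [hDWb]; exact hWb t ht j)
    hJhd (fun x hx i j => hJhe x hx i j)
  refine ⟨U, fun i j => ?_, by rw [← hDh]; exact hrep⟩
  have h := hU i j
  rw [hDZh] at h
  exact h

end PairStepD

end DSSOneShift

end Summit.NavierStokesRegularity.NavierStokesRegularity.Theorems
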